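import Literature.MathematicalPhysics.QuantumFieldTheory.Balaban1983to89.B9Eq349ConjugatedQLetters
import Literature.MathematicalPhysics.QuantumFieldTheory.Balaban1983to89.B9Eq315QTowerLipschitzL2TwoBackgrounds

/-!
# `Balaban1983to89.B9Eq349ConjugatedQTowerLetters` — T. Bałaban, *Propagators for lattice gauge theories in a background field*, Commun. Math. Phys.
# **99** (1985) 389–434 [Balaban1985BackgroundPropagators] (3.15)–(3.16) p. 393, (3.49) p. 399, (3.101)–(3.103) p. 414: **THE COMBES–THOMAS LETTER OF
# THE COMPOSITE VECTOR AVERAGING `Q_k(U) = Q(Ū^{k−1})⋯Q(U)` IN `ℓ²`, BY TELESCOPING OVER THE LEVELS** — with per-level cut-offs `χ_j` on the lattices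
# `T_{L^j m}` and two-block readings `ℓ′_j` between consecutive levels: `√Σ_c‖e^{κχ_0(c₋)}(Q_k e^{−κχ_k}A)(c) − (Q_kA)(c)‖² ≤
# (Π_{j<k}(1 + √(L^d)(θ_j + e_j)) − Π_{j<k}(1 + √(L^d)θ_j))·L^{−kd∕2}·√Σ_b‖A b‖²`, `θ_j = √(2d)·102(d+1)²Lε_j`, `e_j = 2‖κ‖ℓ′_j·√(2(2d(102(d+1)²Lε_j)² + L^{−d}))`

statement-level skeleton of published theorems with citation tags; proofs where landed; nothing here is a claim about the Yang–Mills mass gap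

CITATION HEADER (lean-in-tree rule).  Audit cell `pub-balaban`, sub-cell `t4`, BINDER row NE9; filed by the NE9 BINDER-row OWNER lineage
`b2b-balaban-t4-ne9-p1` (gen 93).  Imports this lineage's `B9Eq349ConjugatedQLetters` (the one-step RAW `ℓ²` brick `sum_norm_sq_QtorusLin_conj_le`) and
`B9Eq315QTowerLipschitzL2TwoBackgrounds` (`sqrt_sum_norm_sq_Qtower_le` — the `ℓ²` size of `Q_n(U)`, flat composite + deviation; through it
`B9Eq315QTowerLipschitzL2` and `B9Eq315QTower`: `towerP`, `UlevOf`, `Qtower`, and the one-step counts).  Sources READ first-hand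
(`paper:balaban1985-cmp99-background-propagators`): p. 393 (3.15) *«Q_j(U) = Q(Ū^{j−1}) … Q(U)»*; p. 399 (3.49); p. 414 (3.101)–(3.103).  Print never conjugates
`Q_k(U)`; the cell's Combes–Thomas route at the tower (ne9-leaf-03's (CDT) `B9Eq326ConjugatedDeltaATower.norm_conjG1k_le`) DISPLAYS the `Q_k(U)`
conjugation letters; the SITE-averaging twin (exact big-block locality) is ne9-leaf-03's `B9Eq349ConjugatedDPChainLettersTower`.  The vector averaging is only
semi-local, so the conjugation is TELESCOPED level by level (this lineage g91's analysis (β): the per-level two-block readings `ℓ′_j` sum to `O(ℓ′)` on the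
physical scale, level-free) — exactly as `B9Eq315QTowerLipschitzL2` telescopes the Lipschitz letter.

WHAT IS PROVED (sorry-free; proof lane — no `def`; [folklore] finite sums; nothing of [B9] asserted).  Data as `B9Eq315QTowerLipschitzL2` §2–§3 (`m`, `hL`,
height `k`, `U` on `T_{L^k m}`, per-level letters `α_j`, `ε_j` with `hα1 hU1 hreg hUε`) plus per-level cut-offs `χ : (j : ℕ) → TSite d (towerP L m j) → ℝ`,
readings `hχ : |χ_j(c₋) − χ_{j+1}(b₋)| ≤ ℓ′_j` for `b₋ ∈ B(c₋) ∪ B(c₊)` (level `j+1 → j`, `j < k` only), windows `‖κ‖ℓ′_j ≤ 1` (`j < k`).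
* §1 `sqrt_sum_norm_add_sq_le'`, `sqrt_sum_norm_sq_le_add_sub'` (Minkowski in `ℓ²`), `conj_QtorusLin_sub_apply` (the raw one-step identity
  `e^{κa}(Q(e^{−κχ}A))(c) − (QA)(c) = (Q((e^{κa}e^{−κχ} − 1)•A))(c)`), `sqrt_sum_norm_sq_QtorusLin_conj_le` (the brick in `√` form: `≤ e·√Σ‖A‖²`);
  the size `√Σ‖Q_nA‖² ≤ Π_{j<n}(1+√(L^d)θ_j)·ρ^n·√Σ‖A‖²` (`ρ = √(L^{−d})`) is `B9Eq315QTowerLipschitzL2TwoBackgrounds.sqrt_sum_norm_sq_Qtower_le` BY NAME.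
* §2 **`sqrt_sum_norm_sq_Qtower_conj_sub_le`**: `∀ n ≤ k, ∀ A, √Σ_c‖e^{κχ_0(c₋)}•Q_n(e^{−κχ_n}•A)(c) − Q_nA(c)‖² ≤ (Π_{j<n}(1+√(L^d)(θ_j+e_j)) − Π_{j<n}(1+√(L^d)θ_j))·
  ρ^n·√Σ‖A‖²` — induction over `Q_{n+1} = Q_n ∘ Q(Ū^n)` with the intermediate weight `e^{∓κχ_n}` inserted: `C_{n+1}A − Q_{n+1}A = [C_n − Q_n](x′) + Q_n(E_nA)`,
  `x′ = Q(Ū^n)A + E_nA`, `‖E_nA‖ ≤ e_n‖A‖` (the brick), Minkowski.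
* §3 **`norm_conj_QkW_sub_le`** — the `dQ` letter ON THE CHAIN's CARRIERS: `‖S_F(Q_{n+1}(U)(S⁻¹f)) − Q_{n+1}(U)f‖_{L²(c₁)} ≤ M_φ′M_φ·√(c₁∕(c₀L^{(n+1)d}))·
  (Π(1+√(L^d)(θ_j+e_j)) − Π(1+√(L^d)θ_j))·‖f‖_{L²(c₀)}` (read through `φ⁻¹` and the weights as `B9Eq315QTowerLipschitzL2` §4; `√(c₁∕(c₀L^{kd})) = 1` on (3.16)),
  `norm_conj_QkW_sub_le_negConj`, **`norm_conj_adjoint_QkW_sub_le`** (the `dQ′` letter: the adjoint reading through leaf-06's `norm_conj_adjoint_sub_le`),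
  **`conj_QadjQ_factor`** (the `hQfac` shape at the tower for ANY linear `Q`) — with INTENT-3 §3's pattern, the complete `hQfac`∕`dQ`∕`dQ′` supply of (CDT).
HONEST SCOPE.  Per-level cut-offs and readings DISPLAYED (their construction from one physical cut-off is the consumer's);
crude constants; nothing of [B9] Thm 3.1∕3.3∕3.11 asserted; «NE9 ⇐ the named binders»; NE9 NOT PRINTED ∕ NOT PROVED; row WALLED ON A MODEL (O-NE9-1; #5 UNRULED);
spine PROVED 0∕9; rung (B)+1 on a finite T⁴ — NOT infinite volume, NOT mass gap, NOT BetaPertH, NOT Clay.  HONEST DEPENDENCY: continuum YM on T⁴ ⇐ BetaPertH ∧ nine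
spine estimates (0/9 proved); BetaPertH ⇐ (D1) ∧ (D4) ∧ CAP+tail.  NEW file; nothing modified.  Net new unproved facts: 0.
-/

noncomputable section

open scoped InnerProductSpace ComplexConjugate BigOperators

namespace Literature.MathematicalPhysics.QuantumFieldTheory.Balaban1983to89.B9Eq349ConjugatedQTowerLetters

open B4Sect5Torus (TSite)
open B9SectCLatticeCarrier (Bond shift)
open B7Prop1Explicit (U1 Wcx boxVec)
open B9Eq319QprimeTorus (fineP blockCoord)
open B9Eq315QTorus (perSite perCfg cornerSite QtorusLin QtorusLin_apply)
open B9Eq315QFlatNorm (sum_norm_sq_QtorusLin_one_le)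
open B9Eq315QLipschitzL2 (sum_norm_sq_QtorusLin_sub_flat_le)
open B9Eq315QTower (towerP UlevOf Qtower Qtower_succ QkOfU)
open B9Eq326OperatorTower (QkW)
open B9Eq311L2Pairing (WL2)
open B11Eq103H1Complex (BondL2K)
open B9Eq315QTowerFlat (UlevOf_one perCfg_UlevOf_one_mem_U1 norm_Wcx_UlevOf_one_sub_one_le)
open B9Eq315QTowerLipschitz (QtorusLin_apply_eq_of_eq)
open B9Eq315QTowerLipschitzL2 (sqrt_sum_norm_sq_Qtower_flat_le sqrt_sum_norm_sq_Qtower_sub_flat_le)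
open B9Eq315QTowerLipschitzL2TwoBackgrounds (sqrt_sum_norm_sq_Qtower_le)
open B9Eq349ConjugatedQLetters (sum_norm_sq_QtorusLin_conj_le)

variable {d : ℕ} (L : ℕ) [NeZero L]

/-! ## §1 Minkowski, the raw one-step identity, the brick and the size of `Q_n` in `ℓ²` -/

omit [NeZero L] in
/-- `√(Σ ‖x_b + y_b‖²) ≤ √(Σ ‖x_b‖²) + √(Σ ‖y_b‖²)` (Cauchy–Schwarz `Real.sum_mul_le_sqrt_mul_sqrt`). [folklore] -/
private theorem sqrt_sum_norm_add_sq_le' {ι : Type*} [Fintype ι] {E : Type*} [SeminormedAddCommGroup E] (x y : ι → E) :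
    Real.sqrt (∑ b, ‖x b + y b‖ ^ 2) ≤ Real.sqrt (∑ b, ‖x b‖ ^ 2) + Real.sqrt (∑ b, ‖y b‖ ^ 2) := by
  have hX : 0 ≤ Real.sqrt (∑ b, ‖x b‖ ^ 2) := Real.sqrt_nonneg _
  have hY : 0 ≤ Real.sqrt (∑ b, ‖y b‖ ^ 2) := Real.sqrt_nonneg _
  have hcs : ∑ b, ‖x b‖ * ‖y b‖ ≤ Real.sqrt (∑ b, ‖x b‖ ^ 2) * Real.sqrt (∑ b, ‖y b‖ ^ 2) := Real.sum_mul_le_sqrt_mul_sqrt _ _ _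
  rw [Real.sqrt_le_left (by positivity)]
  calc ∑ b, ‖x b + y b‖ ^ 2 ≤ ∑ b, (‖x b‖ + ‖y b‖) ^ 2 :=
        Finset.sum_le_sum fun b _ => pow_le_pow_left₀ (norm_nonneg _) (norm_add_le _ _) 2
    _ = ∑ b, ‖x b‖ ^ 2 + 2 * ∑ b, ‖x b‖ * ‖y b‖ + ∑ b, ‖y b‖ ^ 2 := by
        rw [Finset.mul_sum, ← Finset.sum_add_distrib, ← Finset.sum_add_distrib]
        exact Finset.sum_congr rfl fun b _ => by ring
    _ ≤ ∑ b, ‖x b‖ ^ 2 + 2 * (Real.sqrt (∑ b, ‖x b‖ ^ 2) * Real.sqrt (∑ b, ‖y b‖ ^ 2)) + ∑ b, ‖y b‖ ^ 2 := by linarith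
    _ = (Real.sqrt (∑ b, ‖x b‖ ^ 2) + Real.sqrt (∑ b, ‖y b‖ ^ 2)) ^ 2 := by
        rw [add_sq, Real.sq_sqrt (by positivity), Real.sq_sqrt (by positivity)]; ring

omit [NeZero L] in
/-- `√Σ‖x‖² ≤ √Σ‖y‖² + √Σ‖x − y‖²`. [folklore] -/
private theorem sqrt_sum_norm_sq_le_add_sub' {ι : Type*} [Fintype ι] {E : Type*} [SeminormedAddCommGroup E] (x y : ι → E) :
    Real.sqrt (∑ b, ‖x b‖ ^ 2) ≤ Real.sqrt (∑ b, ‖y b‖ ^ 2) + Real.sqrt (∑ b, ‖x b - y b‖ ^ 2) := by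
  have h := sqrt_sum_norm_add_sq_le' y (fun b => x b - y b)
  simp only [add_sub_cancel] at h
  exact h

section Tower

variable {𝔸 : Type*} [NormedRing 𝔸] [NormedAlgebra ℂ 𝔸] [CompleteSpace 𝔸] [NormOneClass 𝔸]
  (m : Fin d → ℕ) [∀ i, NeZero (m i)] (hL : 1 ≤ L) (k : ℕ) (U : Bond d (towerP L m k) → 𝔸ˣ)
  (α : ℕ → ℝ) (hα1 : ∀ j, α j ≤ 1 / 64)
  (hU1 : ∀ (j : ℕ) (x : B7Prop1Explicit.Site d) (κ : Fin d), perCfg (towerP L m (j + 1)) (UlevOf L m k U j) x κ ∈ U1 𝔸)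
  (hreg : ∀ (j : ℕ) (y : TSite d (towerP L m j)) (κ : Fin d) (r : Fin d → Fin L),
    ‖((Wcx L (perCfg (towerP L m (j + 1)) (UlevOf L m k U j)) (cornerSite L y) κ (boxVec L r) : 𝔸ˣ) : 𝔸) - 1‖ ≤ α j)
  (εU : ℕ → ℝ) (hεU : ∀ j, 0 ≤ εU j) (hUε : ∀ (j : ℕ) (b : Bond d (towerP L m (j + 1))), ‖(UlevOf L m k U j b : 𝔸) - 1‖ ≤ εU j)
  {κc : ℂ} (χ : (j : ℕ) → TSite d (towerP L m j) → ℝ) (ℓ' : ℕ → ℝ) (hℓ' : ∀ j, 0 ≤ ℓ' j)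
  (hχ : ∀ j, j < k → ∀ (c : Bond d (towerP L m j)) (b : Bond d (towerP L m (j + 1))),
    (blockCoord L (towerP L m j) b.1 = c.1 ∨ blockCoord L (towerP L m j) b.1 = shift c.2 c.1) → |χ j c.1 - χ (j + 1) b.1| ≤ ℓ' j)
  (hwin : ∀ j, j < k → ‖κc‖ * ℓ' j ≤ 1)

omit [NeZero L] in
/-- **THE RAW ONE-STEP IDENTITY**: `e^{κa}·(Q(V)(e^{−κχ}•A))(c) − (Q(V)A)(c) = (Q(V)((e^{κa}e^{−κχ} − 1)•A))(c)` — linearity of `Q(V)` alone.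
[cite: Balaban1985BackgroundPropagators, (3.15) p.393, (3.101) p.414] -/
theorem conj_QtorusLin_sub_apply {P : Fin d → ℕ} [∀ i, NeZero (fineP L P i)] (V : Bond d (fineP L P) → 𝔸ˣ) {α₀ : ℝ} (hα₀ : α₀ ≤ 1 / 64)
    (hV1 : ∀ (x : B7Prop1Explicit.Site d) (κ : Fin d), perCfg (fineP L P) V x κ ∈ U1 𝔸)
    (hVreg : ∀ (y : TSite d P) (κ : Fin d) (r : Fin d → Fin L), ‖((Wcx L (perCfg (fineP L P) V) (cornerSite L y) κ (boxVec L r) : 𝔸ˣ) : 𝔸) - 1‖ ≤ α₀)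
    (a : ℂ) (σ : Bond d (fineP L P) → ℂ) (A : Bond d (fineP L P) → 𝔸) (c : Bond d P) :
    a • QtorusLin L P hL V hα₀ hV1 hVreg (fun b => σ b • A b) c - QtorusLin L P hL V hα₀ hV1 hVreg A c =
      QtorusLin L P hL V hα₀ hV1 hVreg (fun b => (a * σ b - 1) • A b) c := by
  have hfun : (a • fun b => σ b • A b) - A = fun b => (a * σ b - 1) • A b := by
    funext b; simp only [Pi.sub_apply, Pi.smul_apply, smul_smul, sub_smul, one_smul]
  rw [← Pi.smul_apply a, ← LinearMap.map_smul, ← Pi.sub_apply, ← map_sub, hfun]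

include hεU hUε hℓ' hχ hwin in
/-- **THE BRICK IN `√` FORM AT LEVEL `j`**: `√Σ_c‖(Q(Ū^j)(r_c•A))(c)‖² ≤ e_j·√Σ_b‖A b‖²`, `e_j = 2‖κ‖ℓ′_j·√(2(2d(102(d+1)²Lε_j)² + L^{−d}))`,
`r_c(b) = e^{κχ_j(c₋)}e^{−κχ_{j+1}(b₋)} − 1` (this lineage's `B9Eq349ConjugatedQLetters.sum_norm_sq_QtorusLin_conj_le` at the level-`j` torus).
[cite: Balaban1985BackgroundPropagators, (3.15) p.393, (3.49) p.399, (3.101) p.414] -/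
theorem sqrt_sum_norm_sq_QtorusLin_conj_le (j : ℕ) (hj : j < k) (A : Bond d (towerP L m (j + 1)) → 𝔸) :
    Real.sqrt (∑ c : Bond d (towerP L m j), ‖QtorusLin L (towerP L m j) hL (UlevOf L m k U j) (hα1 j) (hU1 j) (hreg j)
        (fun b => (Complex.exp (κc * (χ j c.1 : ℂ)) * Complex.exp (-(κc * (χ (j + 1) b.1 : ℂ))) - 1) • A b) c‖ ^ 2) ≤
      (2 * (‖κc‖ * ℓ' j) * Real.sqrt (2 * (2 * d * (102 * (d + 1) ^ 2 * L * εU j) ^ 2 + ((L : ℝ) ^ d)⁻¹))) *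
        Real.sqrt (∑ b : Bond d (towerP L m (j + 1)), ‖A b‖ ^ 2) := by
  have hL0 : (0 : ℝ) < L := by exact_mod_cast hL
  have h := sum_norm_sq_QtorusLin_conj_le L (towerP L m j) hL (UlevOf L m k U j) (hα1 j) (hU1 j) (hreg j)
    (show (0 : ℝ) ≤ 1 / 64 by norm_num) (B5Eq172FlatCoercivity.hU1_one L (towerP L m j)) (B5Eq172FlatCoercivity.hreg_one L (towerP L m j))
    (hεU j) (fun b => hUε j b) (hℓ' j) (fun c b hb => hχ j hj c b hb) (hwin j hj) A
  have hR0 : 0 ≤ 2 * (2 * d * (102 * (d + 1) ^ 2 * L * εU j) ^ 2 + ((L : ℝ) ^ d)⁻¹) := by have := hεU j; positivity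
  calc _ ≤ Real.sqrt ((2 * (‖κc‖ * ℓ' j)) ^ 2 * (2 * (2 * d * (102 * (d + 1) ^ 2 * L * εU j) ^ 2 + ((L : ℝ) ^ d)⁻¹)) *
          ∑ b : Bond d (towerP L m (j + 1)), ‖A b‖ ^ 2) := Real.sqrt_le_sqrt h
    _ = _ := by
        rw [Real.sqrt_mul (by positivity), Real.sqrt_mul (by positivity), Real.sqrt_sq (by have := hℓ' j; positivity)]

/-! ## §2 The telescoped conjugation letter -/

include hεU hUε hℓ' hχ hwin in
/-- **THE COMBES–THOMAS LETTER OF `Q_k(U)` IN `ℓ²` (raw, telescoped)**: for every height `n ≤ k` levels and every `A` on the level-`n` bonds,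
`√Σ_c ‖e^{κχ_0(c₋)}•(Q_n(e^{−κχ_n}•A))(c) − (Q_nA)(c)‖² ≤ (Π_{j<n}(1 + √(L^d)(θ_j + e_j)) − Π_{j<n}(1 + √(L^d)θ_j))·(√(L^{−d}))^n·√Σ_b‖A b‖²`,
`θ_j = √(2d)·102(d+1)²Lε_j`, `e_j = 2‖κ‖ℓ′_j·√(2(2d(102(d+1)²Lε_j)² + L^{−d}))` — induction over `Q_{n+1} = Q_n ∘ Q(Ū^n)` inserting `e^{∓κχ_n}`:
`C_{n+1}A − Q_{n+1}A = [C_n − Q_n](x + E_nA) + Q_n(E_nA)`, `x = Q(Ū^n)A`, `‖E_nA‖ ≤ e_n‖A‖` (§1 brick), `‖x‖ ≤ (ρ + θ_n)‖A‖`, `‖Q_n‖ ≤ Π(1+√(L^d)θ_j)ρ^n`,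
Minkowski. [cite: Balaban1985BackgroundPropagators, (3.15)–(3.16) p.393, (3.49) p.399, (3.101)–(3.103) p.414; Balaban1985Averaging, (124)–(127) pp.36–37] -/
theorem sqrt_sum_norm_sq_Qtower_conj_sub_le : ∀ (n : ℕ), n ≤ k → ∀ (A : Bond d (towerP L m n) → 𝔸),
    Real.sqrt (∑ c : Bond d m, ‖Complex.exp (κc * (χ 0 c.1 : ℂ)) •
          Qtower L m hL (UlevOf L m k U) α hα1 hU1 hreg n (fun b => Complex.exp (-(κc * (χ n b.1 : ℂ))) • A b) c -
        Qtower L m hL (UlevOf L m k U) α hα1 hU1 hreg n A c‖ ^ 2) ≤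
      ((∏ j ∈ Finset.range n, (1 + Real.sqrt ((L : ℝ) ^ d) * (Real.sqrt (2 * d) * (102 * (d + 1) ^ 2 * L * εU j) +
          2 * (‖κc‖ * ℓ' j) * Real.sqrt (2 * (2 * d * (102 * (d + 1) ^ 2 * L * εU j) ^ 2 + ((L : ℝ) ^ d)⁻¹))))) -
        ∏ j ∈ Finset.range n, (1 + Real.sqrt ((L : ℝ) ^ d) * (Real.sqrt (2 * d) * (102 * (d + 1) ^ 2 * L * εU j)))) *
        ((Real.sqrt (((L : ℝ) ^ d)⁻¹)) ^ n * Real.sqrt (∑ b : Bond d (towerP L m n), ‖A b‖ ^ 2))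
  | 0, _, A => by
    have h0 : ∀ c : Bond d m, Complex.exp (κc * (χ 0 c.1 : ℂ)) •
        Qtower L m hL (UlevOf L m k U) α hα1 hU1 hreg 0 (fun b => Complex.exp (-(κc * (χ 0 b.1 : ℂ))) • A b) c -
        Qtower L m hL (UlevOf L m k U) α hα1 hU1 hreg 0 A c = 0 := fun c => by
      show Complex.exp (κc * (χ 0 c.1 : ℂ)) • (Complex.exp (-(κc * (χ 0 c.1 : ℂ))) • A c) - A c = 0
      rw [smul_smul, ← Complex.exp_add, add_neg_cancel, Complex.exp_zero, one_smul, sub_self]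
    have hsum : ∑ c : Bond d m, ‖Complex.exp (κc * (χ 0 c.1 : ℂ)) •
        Qtower L m hL (UlevOf L m k U) α hα1 hU1 hreg 0 (fun b => Complex.exp (-(κc * (χ 0 b.1 : ℂ))) • A b) c -
        Qtower L m hL (UlevOf L m k U) α hα1 hU1 hreg 0 A c‖ ^ 2 = 0 :=
      Finset.sum_eq_zero fun c _ => by rw [h0 c, norm_zero, zero_pow two_ne_zero]
    rw [hsum, Real.sqrt_zero, Finset.prod_range_zero, Finset.prod_range_zero, sub_self, zero_mul]
  | n + 1, hn, A => by
    have hL0 : (0 : ℝ) < L := by exact_mod_cast hL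
    have hnk : n < k := hn
    -- shorthands
    set θ : ℕ → ℝ := fun j => Real.sqrt (2 * d) * (102 * (d + 1) ^ 2 * L * εU j) with hθ
    have hθ0 : ∀ j, 0 ≤ θ j := fun j => by rw [hθ]; have := hεU j; positivity
    set e : ℕ → ℝ := fun j => 2 * (‖κc‖ * ℓ' j) * Real.sqrt (2 * (2 * d * (102 * (d + 1) ^ 2 * L * εU j) ^ 2 + ((L : ℝ) ^ d)⁻¹)) with he
    have he0 : ∀ j, 0 ≤ e j := fun j => by rw [he]; have := hℓ' j; positivity
    set ρ : ℝ := Real.sqrt (((L : ℝ) ^ d)⁻¹) with hρ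
    have hρ0 : 0 ≤ ρ := Real.sqrt_nonneg _
    set s : ℝ := Real.sqrt ((L : ℝ) ^ d) with hs
    have hs0 : 0 ≤ s := Real.sqrt_nonneg _
    have hsρ : s * ρ = 1 := by
      rw [hρ, hs, ← Real.sqrt_mul (by positivity), mul_inv_cancel₀ (by positivity), Real.sqrt_one]
    set P : ℝ := ∏ j ∈ Finset.range n, (1 + s * θ j) with hP
    set P' : ℝ := ∏ j ∈ Finset.range n, (1 + s * (θ j + e j)) with hP'
    have hP1 : 1 ≤ P := Finset.one_le_prod (s := Finset.range n) fun j _ => by have := hθ0 j; nlinarith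
    have hPP' : P ≤ P' := Finset.prod_le_prod (fun j _ => by have := hθ0 j; positivity)
      fun j _ => by have := he0 j; nlinarith
    -- the level-`n` objects: `x = Q(Ū^n)A`, the conjugated one-step `x' = e^{κχ_n}•Q(Ū^n)(e^{−κχ_{n+1}}•A)`, `E = x' − x`
    set QA := Qtower L m hL (UlevOf L m k U) α hα1 hU1 hreg with hQA
    set x : Bond d (towerP L m n) → 𝔸 := QtorusLin L (towerP L m n) hL (UlevOf L m k U n) (hα1 n) (hU1 n) (hreg n) A with hx
    set x' : Bond d (towerP L m n) → 𝔸 := fun c => Complex.exp (κc * (χ n c.1 : ℂ)) •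
      QtorusLin L (towerP L m n) hL (UlevOf L m k U n) (hα1 n) (hU1 n) (hreg n) (fun b => Complex.exp (-(κc * (χ (n + 1) b.1 : ℂ))) • A b) c with hx'
    have hE : ∀ c, x' c - x c = QtorusLin L (towerP L m n) hL (UlevOf L m k U n) (hα1 n) (hU1 n) (hreg n)
        (fun b => (Complex.exp (κc * (χ n c.1 : ℂ)) * Complex.exp (-(κc * (χ (n + 1) b.1 : ℂ))) - 1) • A b) c := fun c =>
      conj_QtorusLin_sub_apply L hL _ (hα1 n) (hU1 n) (hreg n) _ _ A c
    -- sizes at level `n`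
    have hNE : Real.sqrt (∑ c, ‖x' c - x c‖ ^ 2) ≤ e n * Real.sqrt (∑ b, ‖A b‖ ^ 2) := by
      have h := sqrt_sum_norm_sq_QtorusLin_conj_le L m hL k U α hα1 hU1 hreg εU hεU hUε χ ℓ' hℓ' hχ hwin n hnk A
      refine le_of_eq_of_le (congrArg Real.sqrt (Finset.sum_congr rfl fun c _ => by rw [hE c])) h
    have hNx : Real.sqrt (∑ c, ‖x c‖ ^ 2) ≤ (ρ + θ n) * Real.sqrt (∑ b, ‖A b‖ ^ 2) := by
      -- flat + deviation at level `n`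
      set y : Bond d (towerP L m n) → 𝔸 := QtorusLin L (towerP L m n) hL (fun _ : Bond d (fineP L (towerP L m n)) => (1 : 𝔸ˣ))
        (show (0 : ℝ) ≤ 1 / 64 by norm_num) (B5Eq172FlatCoercivity.hU1_one L (towerP L m n)) (B5Eq172FlatCoercivity.hreg_one L (towerP L m n)) A with hy
      have hflat : Real.sqrt (∑ b, ‖y b‖ ^ 2) ≤ ρ * Real.sqrt (∑ b, ‖A b‖ ^ 2) := by
        have h := sum_norm_sq_QtorusLin_one_le L (towerP L m n) hL (show (0 : ℝ) ≤ 1 / 64 by norm_num)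
          (B5Eq172FlatCoercivity.hU1_one L (towerP L m n)) (B5Eq172FlatCoercivity.hreg_one L (towerP L m n)) A
        calc Real.sqrt (∑ b, ‖y b‖ ^ 2) ≤ Real.sqrt (((L : ℝ) ^ d)⁻¹ * ∑ b, ‖A b‖ ^ 2) := Real.sqrt_le_sqrt h
          _ = ρ * Real.sqrt (∑ b, ‖A b‖ ^ 2) := Real.sqrt_mul (by positivity) _
      have hdev : Real.sqrt (∑ b, ‖x b - y b‖ ^ 2) ≤ θ n * Real.sqrt (∑ b, ‖A b‖ ^ 2) := by
        have h := sum_norm_sq_QtorusLin_sub_flat_le L (towerP L m n) hL (UlevOf L m k U n) (hα1 n) (hU1 n) (hreg n)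
          (show (0 : ℝ) ≤ 1 / 64 by norm_num) (B5Eq172FlatCoercivity.hU1_one L (towerP L m n)) (B5Eq172FlatCoercivity.hreg_one L (towerP L m n))
          (hεU n) (fun b => hUε n b) A
        calc Real.sqrt (∑ b, ‖x b - y b‖ ^ 2) ≤ Real.sqrt (2 * d * (102 * (d + 1) ^ 2 * L * εU n) ^ 2 * ∑ b, ‖A b‖ ^ 2) := Real.sqrt_le_sqrt h
          _ = Real.sqrt ((θ n) ^ 2 * ∑ b, ‖A b‖ ^ 2) := by
              congr 1; rw [hθ]; simp only [mul_pow, Real.sq_sqrt (by positivity : (0 : ℝ) ≤ 2 * d)]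
          _ = θ n * Real.sqrt (∑ b, ‖A b‖ ^ 2) := by rw [Real.sqrt_mul' _ (by positivity), Real.sqrt_sq (hθ0 n)]
      have h := sqrt_sum_norm_sq_le_add_sub' x y
      nlinarith [hflat, hdev]
    have hNx' : Real.sqrt (∑ c, ‖x' c‖ ^ 2) ≤ (ρ + θ n + e n) * Real.sqrt (∑ b, ‖A b‖ ^ 2) := by
      have h := sqrt_sum_norm_sq_le_add_sub' x' x
      nlinarith [hNx, hNE]
    -- the induction hypothesis at `x'` and the size of `Q_n` at `E = x' − x`
    have ih := sqrt_sum_norm_sq_Qtower_conj_sub_le n (Nat.le_of_succ_le hn) x'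
    have hQn := sqrt_sum_norm_sq_Qtower_le L m hL k U α hα1 hU1 hreg εU hεU hUε n (fun c => x' c - x c)
    -- the split `C_{n+1}A − Q_{n+1}A = [C_n − Q_n](x') + Q_n(x' − x)`
    have hsplit : ∀ c : Bond d m, Complex.exp (κc * (χ 0 c.1 : ℂ)) •
          QA (n + 1) (fun b => Complex.exp (-(κc * (χ (n + 1) b.1 : ℂ))) • A b) c - QA (n + 1) A c =
        (Complex.exp (κc * (χ 0 c.1 : ℂ)) • QA n (fun b => Complex.exp (-(κc * (χ n b.1 : ℂ))) • x' b) c - QA n x' c) +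
          QA n (fun b => x' b - x b) c := by
      intro c
      -- `Q_{n+1}B = Q_n(Q(Ū^n)B)` definitionally, and `Q(Ū^n)(e^{−κχ_{n+1}}A) = e^{−κχ_n}•x'` pointwise
      have e1 : QA (n + 1) (fun b => Complex.exp (-(κc * (χ (n + 1) b.1 : ℂ))) • A b) c =
          QA n (QtorusLin L (towerP L m n) hL (UlevOf L m k U n) (hα1 n) (hU1 n) (hreg n)
            (fun b => Complex.exp (-(κc * (χ (n + 1) b.1 : ℂ))) • A b)) c := rfl
      have e2 : QA (n + 1) A c = QA n x c := rfl
      have e3 : QtorusLin L (towerP L m n) hL (UlevOf L m k U n) (hα1 n) (hU1 n) (hreg n)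
          (fun b => Complex.exp (-(κc * (χ (n + 1) b.1 : ℂ))) • A b) = fun b => Complex.exp (-(κc * (χ n b.1 : ℂ))) • x' b := by
        funext b
        rw [hx']; dsimp only
        rw [smul_smul, ← Complex.exp_add, neg_add_cancel, Complex.exp_zero, one_smul]
      have e4 : (fun b => x' b - x b) = x' - x := rfl
      rw [e1, e2, e3, e4, map_sub, Pi.sub_apply]
      abel
    have hS0 : 0 ≤ Real.sqrt (∑ b : Bond d (towerP L m (n + 1)), ‖A b‖ ^ 2) := Real.sqrt_nonneg _
    have hPdiff0 : 0 ≤ P' - P := by linarith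
    calc Real.sqrt (∑ c : Bond d m, ‖Complex.exp (κc * (χ 0 c.1 : ℂ)) •
            QA (n + 1) (fun b => Complex.exp (-(κc * (χ (n + 1) b.1 : ℂ))) • A b) c - QA (n + 1) A c‖ ^ 2)
        = Real.sqrt (∑ c : Bond d m, ‖(Complex.exp (κc * (χ 0 c.1 : ℂ)) • QA n (fun b => Complex.exp (-(κc * (χ n b.1 : ℂ))) • x' b) c -
            QA n x' c) + QA n (fun b => x' b - x b) c‖ ^ 2) := by
          congr 1; exact Finset.sum_congr rfl fun c _ => by rw [hsplit c]
      _ ≤ Real.sqrt (∑ c : Bond d m, ‖Complex.exp (κc * (χ 0 c.1 : ℂ)) • QA n (fun b => Complex.exp (-(κc * (χ n b.1 : ℂ))) • x' b) c -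
            QA n x' c‖ ^ 2) + Real.sqrt (∑ c : Bond d m, ‖QA n (fun b => x' b - x b) c‖ ^ 2) := sqrt_sum_norm_add_sq_le' _ _
      _ ≤ (P' - P) * (ρ ^ n * Real.sqrt (∑ b, ‖x' b‖ ^ 2)) + P * (ρ ^ n * Real.sqrt (∑ b, ‖x' b - x b‖ ^ 2)) := add_le_add ih hQn
      _ ≤ (P' - P) * (ρ ^ n * ((ρ + θ n + e n) * Real.sqrt (∑ b, ‖A b‖ ^ 2))) + P * (ρ ^ n * (e n * Real.sqrt (∑ b, ‖A b‖ ^ 2))) := by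
          gcongr
      _ = (((P' - P) * (1 + s * (θ n + e n)) + P * (s * e n)) * ρ) * (ρ ^ n * Real.sqrt (∑ b, ‖A b‖ ^ 2)) := by
          linear_combination (-(((P' - P) * (θ n + e n) + P * e n) * ρ ^ n * Real.sqrt (∑ b, ‖A b‖ ^ 2))) * hsρ
      _ = ((∏ j ∈ Finset.range (n + 1), (1 + s * (θ j + e j))) - ∏ j ∈ Finset.range (n + 1), (1 + s * θ j)) *
            (ρ ^ (n + 1) * Real.sqrt (∑ b, ‖A b‖ ^ 2)) := by
          rw [Finset.prod_range_succ, Finset.prod_range_succ, ← hP, ← hP', pow_succ]; ring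

end Tower

/-! ## §3 The reading on the chain's carriers `Q_{n+1}(U) = QkW`: `dQ`, `dQ′`, `hQfac` at the tower -/

section Readings

omit [NeZero L] in
/-- `(√a)^n = √(a^n)` for `a ≥ 0`. [folklore] -/
private theorem sqrt_pow_eq' {a : ℝ} (ha : 0 ≤ a) : ∀ n : ℕ, (Real.sqrt a) ^ n = Real.sqrt (a ^ n)
  | 0 => by simp
  | n + 1 => by rw [pow_succ, sqrt_pow_eq' ha n, pow_succ, Real.sqrt_mul (pow_nonneg ha n)]

variable {𝔸 : Type*} [NormedRing 𝔸] [NormedAlgebra ℂ 𝔸] [CompleteSpace 𝔸] [NormOneClass 𝔸]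
  (m : Fin d → ℕ) [∀ i, NeZero (m i)] (n : ℕ) (hL : 1 ≤ L)
  {W : Type*} [NormedAddCommGroup W] [InnerProductSpace ℂ W] (φ : W ≃ₗ[ℂ] 𝔸) {Mφ Mφ' : ℝ} (hMφ : 0 ≤ Mφ) (hMφ' : 0 ≤ Mφ')
  (hφ : ∀ w, ‖φ w‖ ≤ Mφ * ‖w‖) (hφ' : ∀ X, ‖φ.symm X‖ ≤ Mφ' * ‖X‖) {c₀ c₁ : ℝ} [Fact (0 < c₀)] [Fact (0 < c₁)]
  (U : Bond d (towerP L m (n + 1)) → 𝔸ˣ) (α : ℕ → ℝ) (hα1 : ∀ j, α j ≤ 1 / 64)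
  (hU1 : ∀ (j : ℕ) (x : B7Prop1Explicit.Site d) (κ : Fin d), perCfg (towerP L m (j + 1)) (UlevOf L m (n + 1) U j) x κ ∈ U1 𝔸)
  (hreg : ∀ (j : ℕ) (y : TSite d (towerP L m j)) (κ : Fin d) (r : Fin d → Fin L),
    ‖((Wcx L (perCfg (towerP L m (j + 1)) (UlevOf L m (n + 1) U j)) (cornerSite L y) κ (boxVec L r) : 𝔸ˣ) : 𝔸) - 1‖ ≤ α j)
  (εU : ℕ → ℝ) (hεU : ∀ j, 0 ≤ εU j)
  (hUε : ∀ (j : ℕ) (b : Bond d (towerP L m (j + 1))), ‖(UlevOf L m (n + 1) U j b : 𝔸) - 1‖ ≤ εU j)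
  {κc : ℂ} (χ : (j : ℕ) → TSite d (towerP L m j) → ℝ) (ℓ' : ℕ → ℝ) (hℓ' : ∀ j, 0 ≤ ℓ' j)
  (hχ : ∀ j, j < n + 1 → ∀ (c : Bond d (towerP L m j)) (b : Bond d (towerP L m (j + 1))),
    (blockCoord L (towerP L m j) b.1 = c.1 ∨ blockCoord L (towerP L m j) b.1 = shift c.2 c.1) → |χ j c.1 - χ (j + 1) b.1| ≤ ℓ' j)
  (hwin : ∀ j, j < n + 1 → ‖κc‖ * ℓ' j ≤ 1)
  {Sinv : BondL2K ℂ d (towerP L m (n + 1)) c₀ W →ₗ[ℂ] BondL2K ℂ d (towerP L m (n + 1)) c₀ W}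
  (hSinv : ∀ (f : BondL2K ℂ d (towerP L m (n + 1)) c₀ W) (b : Bond d (towerP L m (n + 1))),
    WL2.equiv ℂ (fun _ : Bond d (towerP L m (n + 1)) => c₀) W (Sinv f) b =
      Complex.exp (-(κc * (χ (n + 1) b.1 : ℂ))) • WL2.equiv ℂ (fun _ : Bond d (towerP L m (n + 1)) => c₀) W f b)
  {SF : BondL2K ℂ d m c₁ W →ₗ[ℂ] BondL2K ℂ d m c₁ W}
  (hSF : ∀ (g : BondL2K ℂ d m c₁ W) (c : Bond d m),
    WL2.equiv ℂ (fun _ : Bond d m => c₁) W (SF g) c = Complex.exp (κc * (χ 0 c.1 : ℂ)) • WL2.equiv ℂ (fun _ : Bond d m => c₁) W g c)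

include hφ hφ' hMφ hMφ' hεU hUε hℓ' hχ hwin hSinv hSF in
/-- **THE `dQ` LETTER AT THE TOWER, ON THE CHAIN's CARRIERS**: `‖S_F(Q_{n+1}(U)(S⁻¹f)) − Q_{n+1}(U)f‖_{L²(c₁)} ≤ M_φ′M_φ·√(c₁∕(c₀L^{(n+1)d}))·
(Π_{j≤n}(1 + √(L^d)(θ_j + e_j)) − Π_{j≤n}(1 + √(L^d)θ_j))·‖f‖_{L²(c₀)}` — §2 at the `𝔸`-valued `Φf`, read through `φ⁻¹` and the two weights exactly as
`B9Eq315QTowerLipschitzL2.norm_QkW_sub_flat_le_L2`; along (3.16) `√(c₁∕(c₀L^{kd})) = (ηL^k)⁻¹ = 1`. [cite: Balaban1985BackgroundPropagators, (3.15)–(3.16) p.393, (3.49) p.399, (3.101) p.414] -/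
theorem norm_conj_QkW_sub_le (f : BondL2K ℂ d (towerP L m (n + 1)) c₀ W) :
    ‖SF (QkW L m n φ U hL α hα1 hU1 hreg (c₀ := c₀) (c₁ := c₁) (Sinv f)) - QkW L m n φ U hL α hα1 hU1 hreg (c₀ := c₀) (c₁ := c₁) f‖ ≤
      Mφ' * Mφ * Real.sqrt (c₁ / (c₀ * ((L : ℝ) ^ (n + 1)) ^ d)) *
        ((∏ j ∈ Finset.range (n + 1), (1 + Real.sqrt ((L : ℝ) ^ d) * (Real.sqrt (2 * d) * (102 * (d + 1) ^ 2 * L * εU j) +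
            2 * (‖κc‖ * ℓ' j) * Real.sqrt (2 * (2 * d * (102 * (d + 1) ^ 2 * L * εU j) ^ 2 + ((L : ℝ) ^ d)⁻¹))))) -
          ∏ j ∈ Finset.range (n + 1), (1 + Real.sqrt ((L : ℝ) ^ d) * (Real.sqrt (2 * d) * (102 * (d + 1) ^ 2 * L * εU j)))) * ‖f‖ := by
  have hc₀ : 0 < c₀ := Fact.out
  have hc₁ : 0 < c₁ := Fact.out
  have hL0 : (0 : ℝ) < L := by exact_mod_cast hL
  set g : Bond d (towerP L m (n + 1)) → 𝔸 := fun b => φ (WL2.equiv ℂ (fun _ : Bond d (towerP L m (n + 1)) => c₀) W f b) with hg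
  set P : ℝ := (∏ j ∈ Finset.range (n + 1), (1 + Real.sqrt ((L : ℝ) ^ d) * (Real.sqrt (2 * d) * (102 * (d + 1) ^ 2 * L * εU j) +
      2 * (‖κc‖ * ℓ' j) * Real.sqrt (2 * (2 * d * (102 * (d + 1) ^ 2 * L * εU j) ^ 2 + ((L : ℝ) ^ d)⁻¹))))) -
    ∏ j ∈ Finset.range (n + 1), (1 + Real.sqrt ((L : ℝ) ^ d) * (Real.sqrt (2 * d) * (102 * (d + 1) ^ 2 * L * εU j))) with hP
  have hP0 : 0 ≤ P := by
    rw [hP, sub_nonneg]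
    exact Finset.prod_le_prod (fun j _ => by have := hεU j; positivity) fun j _ => by
      have := hεU j; have := hℓ' j
      nlinarith [Real.sqrt_nonneg ((L : ℝ) ^ d),
        show (0:ℝ) ≤ Real.sqrt ((L : ℝ) ^ d) * (2 * (‖κc‖ * ℓ' j) * Real.sqrt (2 * (2 * d * (102 * (d + 1) ^ 2 * L * εU j) ^ 2 + ((L : ℝ) ^ d)⁻¹)))
          by positivity]
  -- the fine side: `√(Σ_b ‖g b‖²) ≤ M_φ·‖f‖∕√c₀`
  have hn : ‖f‖ ^ 2 = ∑ b, c₀ * ‖WL2.equiv ℂ (fun _ : Bond d (towerP L m (n + 1)) => c₀) W f b‖ ^ 2 :=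
    WL2.norm_sq (𝕜 := ℂ) (w := fun _ : Bond d (towerP L m (n + 1)) => c₀) (V := W) f
  have hfine : ∑ b, ‖g b‖ ^ 2 ≤ Mφ ^ 2 * (c₀⁻¹ * ‖f‖ ^ 2) := by
    rw [hn, Finset.mul_sum, Finset.mul_sum]
    refine Finset.sum_le_sum fun b _ => ?_
    have h1 : ‖g b‖ ^ 2 ≤ (Mφ * ‖WL2.equiv ℂ (fun _ : Bond d (towerP L m (n + 1)) => c₀) W f b‖) ^ 2 :=
      pow_le_pow_left₀ (norm_nonneg _) (hφ _) 2
    refine h1.trans (le_of_eq ?_)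
    field_simp
  have hfine' : Real.sqrt (∑ b, ‖g b‖ ^ 2) ≤ Mφ * (‖f‖ / Real.sqrt c₀) := by
    calc Real.sqrt (∑ b, ‖g b‖ ^ 2) ≤ Real.sqrt (Mφ ^ 2 * (c₀⁻¹ * ‖f‖ ^ 2)) := Real.sqrt_le_sqrt hfine
      _ = Mφ * (‖f‖ / Real.sqrt c₀) := by
          rw [Real.sqrt_mul' _ (by positivity), Real.sqrt_sq hMφ, Real.sqrt_mul' _ (by positivity), Real.sqrt_sq (norm_nonneg _),
            Real.sqrt_inv, div_eq_inv_mul]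
  -- §2 at `g`
  have htel := sqrt_sum_norm_sq_Qtower_conj_sub_le L m hL (n + 1) U α hα1 hU1 hreg εU hεU hUε χ ℓ' hℓ' hχ hwin (n + 1) le_rfl g
  -- the coarse side, pointwise through `φ⁻¹`
  have hS' : (fun b => φ (WL2.equiv ℂ (fun _ : Bond d (towerP L m (n + 1)) => c₀) W (Sinv f) b)) =
      fun b => Complex.exp (-(κc * (χ (n + 1) b.1 : ℂ))) • g b := funext fun b => by rw [hSinv, LinearEquiv.map_smul]
  have hval : ∀ c : Bond d m, ‖WL2.equiv ℂ (fun _ : Bond d m => c₁) W (SF (QkW L m n φ U hL α hα1 hU1 hreg (c₀ := c₀) (c₁ := c₁) (Sinv f)) -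
        QkW L m n φ U hL α hα1 hU1 hreg (c₀ := c₀) (c₁ := c₁) f) c‖ ^ 2 ≤
      Mφ' ^ 2 * ‖Complex.exp (κc * (χ 0 c.1 : ℂ)) •
          QkOfU L m hL (n + 1) U α hα1 hU1 hreg (fun b => Complex.exp (-(κc * (χ (n + 1) b.1 : ℂ))) • g b) c -
        QkOfU L m hL (n + 1) U α hα1 hU1 hreg g c‖ ^ 2 := by
    intro c
    rw [WL2.equiv_sub, Pi.sub_apply, hSF]
    show ‖Complex.exp (κc * (χ 0 c.1 : ℂ)) • φ.symm (QkOfU L m hL (n + 1) U α hα1 hU1 hreg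
        (fun b => φ (WL2.equiv ℂ (fun _ : Bond d (towerP L m (n + 1)) => c₀) W (Sinv f) b)) c) -
        φ.symm (QkOfU L m hL (n + 1) U α hα1 hU1 hreg g c)‖ ^ 2 ≤ _
    rw [hS', ← LinearEquiv.map_smul, ← map_sub, ← mul_pow]
    exact pow_le_pow_left₀ (norm_nonneg _) (hφ' _) 2
  have hsq : ‖SF (QkW L m n φ U hL α hα1 hU1 hreg (c₀ := c₀) (c₁ := c₁) (Sinv f)) - QkW L m n φ U hL α hα1 hU1 hreg (c₀ := c₀) (c₁ := c₁) f‖ ^ 2 ≤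
      c₁ * Mφ' ^ 2 * ∑ c, ‖Complex.exp (κc * (χ 0 c.1 : ℂ)) •
          QkOfU L m hL (n + 1) U α hα1 hU1 hreg (fun b => Complex.exp (-(κc * (χ (n + 1) b.1 : ℂ))) • g b) c -
        QkOfU L m hL (n + 1) U α hα1 hU1 hreg g c‖ ^ 2 := by
    rw [WL2.norm_sq (𝕜 := ℂ) (w := fun _ : Bond d m => c₁) (V := W), Finset.mul_sum]
    exact Finset.sum_le_sum fun c _ => by
      have := mul_le_mul_of_nonneg_left (hval c) hc₁.le
      linarith [this]
  have hroot : ‖SF (QkW L m n φ U hL α hα1 hU1 hreg (c₀ := c₀) (c₁ := c₁) (Sinv f)) - QkW L m n φ U hL α hα1 hU1 hreg (c₀ := c₀) (c₁ := c₁) f‖ ≤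
      Real.sqrt c₁ * Mφ' * Real.sqrt (∑ c, ‖Complex.exp (κc * (χ 0 c.1 : ℂ)) •
          QkOfU L m hL (n + 1) U α hα1 hU1 hreg (fun b => Complex.exp (-(κc * (χ (n + 1) b.1 : ℂ))) • g b) c -
        QkOfU L m hL (n + 1) U α hα1 hU1 hreg g c‖ ^ 2) := by
    have h := Real.sqrt_le_sqrt hsq
    rw [Real.sqrt_sq (norm_nonneg _), Real.sqrt_mul' _ (Finset.sum_nonneg fun _ _ => by positivity), Real.sqrt_mul' _ (by positivity),
      Real.sqrt_sq hMφ'] at h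
    exact h
  refine hroot.trans ?_
  have hQk : ∑ c, ‖Complex.exp (κc * (χ 0 c.1 : ℂ)) •
          QkOfU L m hL (n + 1) U α hα1 hU1 hreg (fun b => Complex.exp (-(κc * (χ (n + 1) b.1 : ℂ))) • g b) c -
        QkOfU L m hL (n + 1) U α hα1 hU1 hreg g c‖ ^ 2 =
      ∑ c : Bond d m, ‖Complex.exp (κc * (χ 0 c.1 : ℂ)) •
          Qtower L m hL (UlevOf L m (n + 1) U) α hα1 hU1 hreg (n + 1) (fun b => Complex.exp (-(κc * (χ (n + 1) b.1 : ℂ))) • g b) c -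
        Qtower L m hL (UlevOf L m (n + 1) U) α hα1 hU1 hreg (n + 1) g c‖ ^ 2 := rfl
  rw [hQk]
  calc Real.sqrt c₁ * Mφ' * Real.sqrt (∑ c : Bond d m, ‖Complex.exp (κc * (χ 0 c.1 : ℂ)) •
          Qtower L m hL (UlevOf L m (n + 1) U) α hα1 hU1 hreg (n + 1) (fun b => Complex.exp (-(κc * (χ (n + 1) b.1 : ℂ))) • g b) c -
          Qtower L m hL (UlevOf L m (n + 1) U) α hα1 hU1 hreg (n + 1) g c‖ ^ 2)
      ≤ Real.sqrt c₁ * Mφ' * (P * ((Real.sqrt (((L : ℝ) ^ d)⁻¹)) ^ (n + 1) * Real.sqrt (∑ b, ‖g b‖ ^ 2))) :=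
        mul_le_mul_of_nonneg_left htel (by positivity)
    _ ≤ Real.sqrt c₁ * Mφ' * (P * ((Real.sqrt (((L : ℝ) ^ d)⁻¹)) ^ (n + 1) * (Mφ * (‖f‖ / Real.sqrt c₀)))) := by gcongr
    _ = Mφ' * Mφ * Real.sqrt (c₁ / (c₀ * ((L : ℝ) ^ (n + 1)) ^ d)) * P * ‖f‖ := by
        have hρ : (Real.sqrt (((L : ℝ) ^ d)⁻¹)) ^ (n + 1) = Real.sqrt ((((L : ℝ) ^ (n + 1)) ^ d)⁻¹) := by
          rw [sqrt_pow_eq' (by positivity : (0:ℝ) ≤ ((L : ℝ) ^ d)⁻¹) (n + 1)]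
          congr 1
          rw [inv_pow, ← pow_mul, ← pow_mul, Nat.mul_comm d (n + 1)]
        have hsplit : Real.sqrt (c₁ / (c₀ * ((L : ℝ) ^ (n + 1)) ^ d)) = Real.sqrt c₁ * (Real.sqrt ((((L : ℝ) ^ (n + 1)) ^ d)⁻¹) * (Real.sqrt c₀)⁻¹) := by
          rw [div_eq_mul_inv, mul_inv, Real.sqrt_mul hc₁.le, Real.sqrt_mul (inv_nonneg.2 hc₀.le), Real.sqrt_inv c₀]
          ring
        rw [hρ, hsplit, div_eq_mul_inv]
        ring

variable {S : BondL2K ℂ d (towerP L m (n + 1)) c₀ W →ₗ[ℂ] BondL2K ℂ d (towerP L m (n + 1)) c₀ W}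
  (hS : ∀ (f : BondL2K ℂ d (towerP L m (n + 1)) c₀ W) (b : Bond d (towerP L m (n + 1))),
    WL2.equiv ℂ (fun _ : Bond d (towerP L m (n + 1)) => c₀) W (S f) b =
      Complex.exp (κc * (χ (n + 1) b.1 : ℂ)) • WL2.equiv ℂ (fun _ : Bond d (towerP L m (n + 1)) => c₀) W f b)
  {SFinv : BondL2K ℂ d m c₁ W →ₗ[ℂ] BondL2K ℂ d m c₁ W}
  (hSFinv : ∀ (g : BondL2K ℂ d m c₁ W) (c : Bond d m),
    WL2.equiv ℂ (fun _ : Bond d m => c₁) W (SFinv g) c = Complex.exp (-(κc * (χ 0 c.1 : ℂ))) • WL2.equiv ℂ (fun _ : Bond d m => c₁) W g c)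

include hφ hφ' hMφ hMφ' hεU hUε hℓ' hχ hwin hS hSFinv in
/-- **… AT `−κ̄` THROUGH THE ADJOINTS' POINTWISE ACTION** (`S† = e^{κ̄χ_{n+1}}`, `(S_F⁻¹)† = e^{−κ̄χ_0}`, `B9Eq311PointwiseMultipliers.equiv_adjoint_of_pointwise`).
[folklore] [cite: Balaban1985BackgroundPropagators, (3.15) p.393, (3.49) p.399, (3.101) p.414] -/
theorem norm_conj_QkW_sub_le_negConj [FiniteDimensional ℂ W] (f : BondL2K ℂ d (towerP L m (n + 1)) c₀ W) :
    ‖LinearMap.adjoint SFinv (QkW L m n φ U hL α hα1 hU1 hreg (c₀ := c₀) (c₁ := c₁) (LinearMap.adjoint S f)) -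
        QkW L m n φ U hL α hα1 hU1 hreg (c₀ := c₀) (c₁ := c₁) f‖ ≤
      Mφ' * Mφ * Real.sqrt (c₁ / (c₀ * ((L : ℝ) ^ (n + 1)) ^ d)) *
        ((∏ j ∈ Finset.range (n + 1), (1 + Real.sqrt ((L : ℝ) ^ d) * (Real.sqrt (2 * d) * (102 * (d + 1) ^ 2 * L * εU j) +
            2 * (‖κc‖ * ℓ' j) * Real.sqrt (2 * (2 * d * (102 * (d + 1) ^ 2 * L * εU j) ^ 2 + ((L : ℝ) ^ d)⁻¹))))) -
          ∏ j ∈ Finset.range (n + 1), (1 + Real.sqrt ((L : ℝ) ^ d) * (Real.sqrt (2 * d) * (102 * (d + 1) ^ 2 * L * εU j)))) * ‖f‖ := by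
  have hA : ∀ (g : BondL2K ℂ d m c₁ W) (c : Bond d m),
      WL2.equiv ℂ (fun _ : Bond d m => c₁) W (LinearMap.adjoint SFinv g) c =
        Complex.exp (-conj κc * (χ 0 c.1 : ℂ)) • WL2.equiv ℂ (fun _ : Bond d m => c₁) W g c := by
    intro g c
    rw [B9Eq311PointwiseMultipliers.equiv_adjoint_of_pointwise SFinv _ hSFinv, ← Complex.exp_conj, map_neg, map_mul, Complex.conj_ofReal,
      neg_mul]
  have hB : ∀ (f : BondL2K ℂ d (towerP L m (n + 1)) c₀ W) (b : Bond d (towerP L m (n + 1))),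
      WL2.equiv ℂ (fun _ : Bond d (towerP L m (n + 1)) => c₀) W (LinearMap.adjoint S f) b =
        Complex.exp (-(-conj κc * (χ (n + 1) b.1 : ℂ))) • WL2.equiv ℂ (fun _ : Bond d (towerP L m (n + 1)) => c₀) W f b := by
    intro f b
    rw [B9Eq311PointwiseMultipliers.equiv_adjoint_of_pointwise S _ hS, ← Complex.exp_conj, map_mul, Complex.conj_ofReal, neg_mul, neg_neg]
  have hwin1 : ∀ j, j < n + 1 → ‖-conj κc‖ * ℓ' j ≤ 1 := fun j hj => by rw [norm_neg, Complex.norm_conj]; exact hwin j hj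
  have h := norm_conj_QkW_sub_le L m n hL φ hMφ hMφ' hφ hφ' (c₀ := c₀) (c₁ := c₁) U α hα1 hU1 hreg εU hεU hUε χ ℓ' hℓ' hχ hwin1 hB hA f
  simpa only [norm_neg, Complex.norm_conj] using h

include hφ hφ' hMφ hMφ' hεU hUε hℓ' hχ hwin hS hSFinv in
/-- **THE ADJOINT READING `dQ′` AT THE TOWER: `‖(S ∘ Q_{n+1}(U)† ∘ S_F⁻¹)g − Q_{n+1}(U)†g‖ ≤` the same `× ‖g‖`** (a bound passes through the pairing,
`B9Eq311PointwiseMultipliers.norm_conj_adjoint_sub_le`). [folklore] [cite: Balaban1985BackgroundPropagators, (3.15)–(3.16) p.393, (3.26) p.395, (3.49) p.399] -/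
theorem norm_conj_adjoint_QkW_sub_le [FiniteDimensional ℂ W] (g : BondL2K ℂ d m c₁ W) :
    ‖(S ∘ₗ LinearMap.adjoint (QkW L m n φ U hL α hα1 hU1 hreg (c₀ := c₀) (c₁ := c₁)) ∘ₗ SFinv) g -
        LinearMap.adjoint (QkW L m n φ U hL α hα1 hU1 hreg (c₀ := c₀) (c₁ := c₁)) g‖ ≤
      Mφ' * Mφ * Real.sqrt (c₁ / (c₀ * ((L : ℝ) ^ (n + 1)) ^ d)) *
        ((∏ j ∈ Finset.range (n + 1), (1 + Real.sqrt ((L : ℝ) ^ d) * (Real.sqrt (2 * d) * (102 * (d + 1) ^ 2 * L * εU j) +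
            2 * (‖κc‖ * ℓ' j) * Real.sqrt (2 * (2 * d * (102 * (d + 1) ^ 2 * L * εU j) ^ 2 + ((L : ℝ) ^ d)⁻¹))))) -
          ∏ j ∈ Finset.range (n + 1), (1 + Real.sqrt ((L : ℝ) ^ d) * (Real.sqrt (2 * d) * (102 * (d + 1) ^ 2 * L * εU j)))) * ‖g‖ := by
  have hc₀ : 0 < c₀ := Fact.out
  have hc₁ : 0 < c₁ := Fact.out
  have hP0 : 0 ≤ Mφ' * Mφ * Real.sqrt (c₁ / (c₀ * ((L : ℝ) ^ (n + 1)) ^ d)) *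
      ((∏ j ∈ Finset.range (n + 1), (1 + Real.sqrt ((L : ℝ) ^ d) * (Real.sqrt (2 * d) * (102 * (d + 1) ^ 2 * L * εU j) +
          2 * (‖κc‖ * ℓ' j) * Real.sqrt (2 * (2 * d * (102 * (d + 1) ^ 2 * L * εU j) ^ 2 + ((L : ℝ) ^ d)⁻¹))))) -
        ∏ j ∈ Finset.range (n + 1), (1 + Real.sqrt ((L : ℝ) ^ d) * (Real.sqrt (2 * d) * (102 * (d + 1) ^ 2 * L * εU j)))) := by
    refine mul_nonneg (by positivity) (sub_nonneg.2 (Finset.prod_le_prod (fun j _ => by have := hεU j; positivity) fun j _ => ?_))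
    have := hεU j; have := hℓ' j
    nlinarith [Real.sqrt_nonneg ((L : ℝ) ^ d),
      show (0:ℝ) ≤ Real.sqrt ((L : ℝ) ^ d) * (2 * (‖κc‖ * ℓ' j) * Real.sqrt (2 * (2 * d * (102 * (d + 1) ^ 2 * L * εU j) ^ 2 + ((L : ℝ) ^ d)⁻¹)))
        by positivity]
  exact B9Eq311PointwiseMultipliers.norm_conj_adjoint_sub_le (𝕜 := ℂ) (E := BondL2K ℂ d (towerP L m (n + 1)) c₀ W) (F := BondL2K ℂ d m c₁ W)
    (QkW L m n φ U hL α hα1 hU1 hreg (c₀ := c₀) (c₁ := c₁)) SFinv S hP0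
    (fun f => by
      rw [LinearMap.comp_apply, LinearMap.comp_apply]
      exact norm_conj_QkW_sub_le_negConj L m n hL φ hMφ hMφ' hφ hφ' U α hα1 hU1 hreg εU hεU hUε χ ℓ' hℓ' hχ hwin hS hSFinv f) g

omit [NeZero L] [∀ i, NeZero (m i)] [CompleteSpace 𝔸] [NormOneClass 𝔸] in
/-- **THE FACTORISATION `S(Q†(a•Q(S⁻¹f))) = a•(S∘Q†∘S_F⁻¹)((S_F∘Q∘S⁻¹)f)`** given `S_F⁻¹S_F = 1`, for ANY linear `Q` between the tower's carriers —
(CDT)'s `hQfac` with `Qk := S_F ∘ₗ Q ∘ₗ Sinv`, `Qk′ := S ∘ₗ Q† ∘ₗ S_Finv`. [folklore] [cite: Balaban1985BackgroundPropagators, (3.26) p.395, (3.49) p.399] -/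
theorem conj_QadjQ_factor [FiniteDimensional ℂ W] (Q : BondL2K ℂ d (towerP L m (n + 1)) c₀ W →ₗ[ℂ] BondL2K ℂ d m c₁ W)
    (S : BondL2K ℂ d (towerP L m (n + 1)) c₀ W →ₗ[ℂ] BondL2K ℂ d (towerP L m (n + 1)) c₀ W) (SFinv : BondL2K ℂ d m c₁ W →ₗ[ℂ] BondL2K ℂ d m c₁ W)
    (hSFinvSF : ∀ g, SFinv (SF g) = g) (a : ℝ) (f : BondL2K ℂ d (towerP L m (n + 1)) c₀ W) :
    S (LinearMap.adjoint Q (((a : ℝ) : ℂ) • Q (Sinv f))) =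
      ((a : ℝ) : ℂ) • (S ∘ₗ LinearMap.adjoint Q ∘ₗ SFinv) ((SF ∘ₗ Q ∘ₗ Sinv) f) := by
  simp only [LinearMap.comp_apply, hSFinvSF, map_smul]

end Readings


end Literature.MathematicalPhysics.QuantumFieldTheory.Balaban1983to89.B9Eq349ConjugatedQTowerLetters

end
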